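import Literature.MathematicalPhysics.QuantumFieldTheory.Balaban1983to89.Node00.N24NodesStage13FourPinPointed
import Literature.MathematicalPhysics.QuantumFieldTheory.Balaban1983to89.Node00.Record13CarriersXPinned

/-!
# BalabanUVNodes ∕ N10 — THE K1‴ ENGINE AT THE X-PINNED STAGE-13 PRESENTATION `θ.pinX3 lam8 lam12 lam13` (`Node00/Record13CarriersXPinned`): dag-n24-c's module 40
# `N24_nodes₁₃B10YZW_pointed` BY NAME with its three X-reading sockets — N05 `h05`, N09 `h09`, N10 `h10` — READ AS THE THREE LEAVES OF RECORD at `(lam8, lam12, lam13)`,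
# the nine other sockets at the pinned parameter, the datum `θ`'s own (Track A, DAG node N10 [B13]; strategy s2; seat `pub-ymgap-dag-n10-d` g6 — the end-to-end kernel
# demonstration behind LOCATED-N24-XSOCKET ∕ -XPIN3-HEARTBEAT; composite, count-neutral)

HONEST FRAMING.  Count-neutral kernel bookkeeping BY NAME over LANDED modules: dag-n24-c's module 40 (p492955, θ-GENERIC: the thirteen DAG nodes at a world bound to the
four-pin Stage-13 view from thirteen displayed sockets) and this seat's `Node00/Record13CarriersXPinned` (the one-level X-pin `Stage13Params.pinX3` with faces `pinX3_*`,
`Provisos₁₃.pinX3`, `datumOfRecord₁₃_pinX3`, and the three socket identities `socket05∕09∕10_pinX3_iff`, all `rfl`∕`Iff.rfl`).  §1 THE THIRTEEN NODES AT A WORLD BOUND TO THE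
FOUR-PIN VIEW OF `θ.pinX3 lam8 lam12 lam13`: the engine at the pinned parameter with `h05 ↦` dag-n05-d's typed [B8″] leaf form at `lam8`, `h09 ↦ Lemma4Printed (F12OfRecord₁₂ …
lam12 P) (lam12 P).consts`, `h10 ↦ B13LeafOfRecord θ₃ (lam13 P)` — the three X-reading children AT THEIR GROUPS OF RECORD —, the nine carrier-blind sockets module 40's at the
pinned parameter textually (θ-generic child engines instantiate there; every object is `θ`'s own by `pinX3_*`), `Provisos₁₃` ∕ admissibility ∕ THE DATUM read at `θ`; conclusion
`IsRecordOfRecord₁₃C F N (datumOfRecord₁₃ F N θ hP) w ∧ ∀ P, Nodes (leavesP w P)`.  §2 the `NodesAtSomeRecord13`-shaped ∃-form witnessed by `(θ, hP, w)` (guard `hU` displayed —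
at K0a's member `θL F n ε₂₉` it is `⟨ztUnity_theta13LiveOfNumerics …, slotsNondegenerate₁₃_theta13LiveOfNumerics … hP⟩`, admissibility `admissible_theta13LiveOfNumerics … hn hε'`,
`hP` from row P11 by `provisos₁₃_theta13LiveOfNumerics_of_bg` — three lines for the K1‴ closer; not restated here).  COMPOSITE: every socket is a hypothesis (the three leaves
included — N05's in the C-binding form AS TYPED in module 40; dag-n05-d's S-binding home and ref-C (B8-2) untouched); nothing discharged; NOT `stub_nodes13`; nothing of
Bałaban's asserted; N05 ∕ N09 ∕ N10 ∕ N24 NOT discharged; no count moves; one finite four-torus programme at fixed ε per run; nothing continuum ∕ ℝ⁴ ∕ OS ∕ mass-gap ∕ Clay.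
0 `sorry`, 0 `def`, standard axioms.  Filed `--supports` K1‴ «StabilityBAtRecordR13e» (stmt-QuantumFields-19910) of route «BalabanUVNodes».

WHAT THIS FILE PROVES.  §1 `nodes₁₃B10YZW_pointed_pinX3_of_leaves`; §2 `nodesAtSomeRecord₁₃_shape_pinX3_of_leaves`.
-/

namespace Summit.QuantumFields.YangMills.BalabanUVNodes.N10AtXPinned13

open Literature.MathematicalPhysics.QuantumFieldTheory.Balaban1983to89
open Literature.MathematicalPhysics.QuantumFieldTheory.Balaban1983to89.T4Continuum
open Literature.MathematicalPhysics.QuantumFieldTheory.Balaban1983to89.T4DatumAssembly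
open Literature.MathematicalPhysics.QuantumFieldTheory.Balaban1983to89.DagBinding
open Literature.MathematicalPhysics.QuantumFieldTheory.Balaban1983to89.FlowStepRuns
open Literature.MathematicalPhysics.QuantumFieldTheory.Balaban1983to89.AveragingRT
open Literature.MathematicalPhysics.QuantumFieldTheory.Balaban1983to89.B8IdxB8LawsB (IdxB8SubB famB8OfRecordSubB)
open Literature.MathematicalPhysics.QuantumFieldTheory.Balaban1983to89.Node00
open scoped Matrix.Norms.L2Operator

variable {F : T4Family} {N : ℕ} [NeZero N]

/-! ## §1. The thirteen nodes at a world bound to the four-pin view of the X-pinned parameter, the three X-reading children at their groups of record -/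

/-- **THE THIRTEEN DAG NODES AT A WORLD BOUND TO THE FOUR-PIN STAGE-13 VIEW OF `θ.pinX3 lam8 lam12 lam13`, N05 ∕ N09 ∕ N10 ← THEIR LEAVES OF RECORD** — dag-n24-c's
`N24_nodes₁₃B10YZW_pointed` at the pinned parameter with `h05 := (socket05_pinX3_iff …).2 (h05 P)`, `h09 := (socket09_pinX3_iff …).2 (h09 P)`, `h10 :=
socket10_pinX3_of_leafOfRecord … h10 …`; the nine other sockets at the pinned parameter; `Provisos₁₃` ∕ admissibility ∕ the datum read at `θ` (`Provisos₁₃.pinX3`,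
`pinX3_admissible_iff`, `datumOfRecord₁₃_pinX3`).  COMPOSITE; nothing discharged. [cite: Balaban1985RegularSpaces, Thm 2 p.83; Balaban1987RG1, Lemma 4 p.280, Thm 1 p.259, Thm 3 p.264; Balaban1988RG2Cluster, Lemmas 1–3 pp.9, 11, 20; Balaban1989LargeFieldII, Thm 1 p.355, (0.1) pp.355–356, p.391; Balaban1985UV3, Thm 1 p.257 + Thm 2 p.272; Balaban1985BackgroundPropagators, Thm 3.1 p.397; Balaban1985Variational, Thm 1 p.279; Balaban1988Convergent, Thm 1 p.262, (2.18) p.257, Cor. 3 (2.50) p.264; Balaban1989LargeFieldI, Prop. 1 p.194 (bookkeeping)] -/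
theorem nodes₁₃B10YZW_pointed_pinX3_of_leaves (θ : Stage13Params F N) (hP : θ.Provisos₁₃ F N) (hθ : θ.Admissible F N)
    (lam8 : ResidB8 θ.toStage3Params) (lam12 : ResidB12 F N θ.τ9.M) (lam13 : B12.RunParams → ResidB13 θ.toStage3Params)
    (Mstar : ℕ) (ops : OpsY N (θ.pinX3 F N lam8 lam12 lam13).toStage3Params Mstar) (ζ : ResidZ F N) (lamW : ResidW F N) (w : WorldP)
    (hC : w.C = (datumOfRecord₁₃ F N θ hP).C) (hγ : 0 < w.γ ∧ w.γ ≤ (θ.pinX3 F N lam8 lam12 lam13).γ) (hL : w.L = ((θ.pinX3 F N lam8 lam12 lam13).L : ℝ))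
    (hup : ∀ P, w.up P = upOfRecord₅C F N ((θ.pinX3 F N lam8 lam12 lam13).view₁₃B10YZW F N Mstar ops ζ lamW) P)
    -- N05 ∕ N09 ∕ N10: THE THREE X-READING SOCKETS ← the three leaves of record at (lam8, lam12, lam13)
    (h05 : ∀ P : B12.RunParams, B8LeafR θ.D (θ.L : ℝ) lam8.C₂ lam8.B₁' lam8.inp.B₀' lam8.B₁ lam8.B₂ lam8.c₁ lam8.inp lam8.B₀β
      (B8Lemma1NonAbelian.blockPairNA θ.D θ.L θ.𝔸) (fun j : IdxB8SubB θ.toStage3Params => famB8OfRecordSubB θ.toStage3Params lam8.β lam8.len j) lam8.lan lam8.cub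
      (fun j => lam8.toAxial j.1))
    (h09 : ∀ P : B12.RunParams, B12Sec2to5.Lemma4Printed (F12OfRecord₁₂ F N θ.toStage12Params lam12 P) (lam12 P).consts)
    (h10 : ∀ P : B12.RunParams, B13LeafOfRecord θ.toStage3Params (lam13 P))
    -- the nine other sockets, module 40's AT THE PINNED PARAMETER (each object = θ's own by `pinX3_*`, `Record13CarriersXPinned` §1)
    (h06 : B9LeafX (Y9OfRecord N (θ.pinX3 F N lam8 lam12 lam13).toStage3Params Mstar ops))
    (h07 : B11Leaf (Z11OfRecord F N ζ))
    (h08 : PrintedUV3V N (θ.pinX3 F N lam8 lam12 lam13).L)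
    (h09T : ∀ P : B12.RunParams, (leavesP w P).smallCouplings → (leavesP w P).smallFieldInductive)
    (h11 : ∀ P : B12.RunParams, (leavesP w P).b7 → (leavesP w P).b8 → (leavesP w P).b9 → (leavesP w P).b10 → (leavesP w P).b11 →
      (leavesP w P).smallCouplings → (leavesP w P).smallFieldInductive → (leavesP w P).flowControl →
        ∀ k, k < P.K → SLaw₁₃ F N (θ.pinX3 F N lam8 lam12 lam13) P k → TLaw₁₃ F N (θ.pinX3 F N lam8 lam12 lam13) P k)
    (h12 : ∀ P : B12.RunParams, B15Leaf (WOfRecord₁₃ F N (θ.pinX3 F N lam8 lam12 lam13) lamW P))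
    (hR : ∀ (P : B12.RunParams) (k : ℕ), k < P.K → TLaw₁₃ F N (θ.pinX3 F N lam8 lam12 lam13) P k → SLaw₁₃ F N (θ.pinX3 F N lam8 lam12 lam13) P (k + 1))
    (hUV : ∀ P : B12.RunParams, (genFlow (betaOfRecord₁₃ F N (θ.pinX3 F N lam8 lam12 lam13)) P.g0).InInterval w.γ P.K → ∀ k, k ≤ P.K →
      SLaw₁₃ F N (θ.pinX3 F N lam8 lam12 lam13) P k → ∀ U : GaugeField (F.P P.K) k (SU N),
        chiβOfRecord₁₃ F N (θ.pinX3 F N lam8 lam12 lam13) P.K (gOfRecord₁₃ F N (θ.pinX3 F N lam8 lam12 lam13) P) k U *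
              Real.exp (-(1 / (gOfRecord₁₃ F N (θ.pinX3 F N lam8 lam12 lam13) P k) ^ 2 * wilsonBGOfRecord F N (θ.pinX3 F N lam8 lam12 lam13).εbg P k U)
                - w.em (gOfRecord₁₃ F N (θ.pinX3 F N lam8 lam12 lam13) P k) * (Fintype.card (Site (F.P P.K) k) : ℝ)) ≤
            densOfRecord₁₃ F N (θ.pinX3 F N lam8 lam12 lam13) P k U ∧
        densOfRecord₁₃ F N (θ.pinX3 F N lam8 lam12 lam13) P k U ≤
          Real.exp (w.ep (gOfRecord₁₃ F N (θ.pinX3 F N lam8 lam12 lam13) P k) * (Fintype.card (Site (F.P P.K) k) : ℝ))) :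
    IsRecordOfRecord₁₃C F N (datumOfRecord₁₃ F N θ hP) w ∧ ∀ P : B12.RunParams, Nodes (leavesP w P) := by
  have hC' : w.C = (datumOfRecord₁₃ F N (θ.pinX3 F N lam8 lam12 lam13) (hP.pinX3 lam8 lam12 lam13)).C := by rw [datumOfRecord₁₃_pinX3]; exact hC
  have key := N24_nodes₁₃B10YZW_pointed (θ.pinX3 F N lam8 lam12 lam13) (hP.pinX3 lam8 lam12 lam13)
    ((Stage13Params.pinX3_admissible_iff F N θ lam8 lam12 lam13).2 hθ) Mstar ops ζ lamW w hC' hγ hL hup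
    (fun P => (socket05_pinX3_iff F N θ lam8 lam12 lam13 P).2 (h05 P)) h06 h07 h08
    (fun P => (socket09_pinX3_iff F N θ lam8 lam12 lam13 P).2 (h09 P)) h09T
    (socket10_pinX3_of_leafOfRecord F N θ lam8 lam12 lam13 h10 Mstar ops ζ lamW) h11 h12 hR hUV
  rwa [datumOfRecord₁₃_pinX3] at key

/-! ## §2. The `NodesAtSomeRecord13`-shaped ∃-form, witnessed by `(θ, hP, w)` -/

/-- **THE `NodesAtSomeRecord13`-SHAPED ∃-FORM AT THE X-PINNED PRESENTATION, WITNESSED BY `(θ, hP, w)` ITSELF** (guard `hU` and admissibility read at `θ`).  At `N := 2` and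
`θ :=` K0a's member `θL F n ε₂₉` (guard ∕ admissibility ∕ `hP` by K0a's theorems) this is the ∃-body of plan g66's `NodesAtSomeRecord13 F`, GIVEN the nine carrier-blind
sockets at `θL.pinX3 …` and the three leaves of record.  COMPOSITE; NOT the stub. [cite: Balaban1989LargeFieldII, Thm 1 p.355, (0.1) pp.355–356; Balaban1988Convergent, Thm 1 p.262, (3.16)–(3.22) pp.268–269; Balaban1989LargeFieldI, (0.3)–(0.4) p.176; Balaban1988RG2Cluster, Lemmas 1–3 pp.9–20 (bookkeeping)] -/
theorem nodesAtSomeRecord₁₃_shape_pinX3_of_leaves (θ : Stage13Params F N) (hP : θ.Provisos₁₃ F N) (hθ : θ.Admissible F N)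
    (hU : θ.ZtUnity F N ∧ θ.SlotsNondegenerate₁₃ F N)
    (lam8 : ResidB8 θ.toStage3Params) (lam12 : ResidB12 F N θ.τ9.M) (lam13 : B12.RunParams → ResidB13 θ.toStage3Params)
    (Mstar : ℕ) (ops : OpsY N (θ.pinX3 F N lam8 lam12 lam13).toStage3Params Mstar) (ζ : ResidZ F N) (lamW : ResidW F N) (w : WorldP)
    (hC : w.C = (datumOfRecord₁₃ F N θ hP).C) (hγ : 0 < w.γ ∧ w.γ ≤ (θ.pinX3 F N lam8 lam12 lam13).γ) (hL : w.L = ((θ.pinX3 F N lam8 lam12 lam13).L : ℝ))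
    (hup : ∀ P, w.up P = upOfRecord₅C F N ((θ.pinX3 F N lam8 lam12 lam13).view₁₃B10YZW F N Mstar ops ζ lamW) P)
    -- N05 ∕ N09 ∕ N10: THE THREE X-READING SOCKETS ← the three leaves of record at (lam8, lam12, lam13)
    (h05 : ∀ P : B12.RunParams, B8LeafR θ.D (θ.L : ℝ) lam8.C₂ lam8.B₁' lam8.inp.B₀' lam8.B₁ lam8.B₂ lam8.c₁ lam8.inp lam8.B₀β
      (B8Lemma1NonAbelian.blockPairNA θ.D θ.L θ.𝔸) (fun j : IdxB8SubB θ.toStage3Params => famB8OfRecordSubB θ.toStage3Params lam8.β lam8.len j) lam8.lan lam8.cub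
      (fun j => lam8.toAxial j.1))
    (h09 : ∀ P : B12.RunParams, B12Sec2to5.Lemma4Printed (F12OfRecord₁₂ F N θ.toStage12Params lam12 P) (lam12 P).consts)
    (h10 : ∀ P : B12.RunParams, B13LeafOfRecord θ.toStage3Params (lam13 P))
    -- the nine other sockets, module 40's AT THE PINNED PARAMETER (each object = θ's own by `pinX3_*`, `Record13CarriersXPinned` §1)
    (h06 : B9LeafX (Y9OfRecord N (θ.pinX3 F N lam8 lam12 lam13).toStage3Params Mstar ops))
    (h07 : B11Leaf (Z11OfRecord F N ζ))
    (h08 : PrintedUV3V N (θ.pinX3 F N lam8 lam12 lam13).L)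
    (h09T : ∀ P : B12.RunParams, (leavesP w P).smallCouplings → (leavesP w P).smallFieldInductive)
    (h11 : ∀ P : B12.RunParams, (leavesP w P).b7 → (leavesP w P).b8 → (leavesP w P).b9 → (leavesP w P).b10 → (leavesP w P).b11 →
      (leavesP w P).smallCouplings → (leavesP w P).smallFieldInductive → (leavesP w P).flowControl →
        ∀ k, k < P.K → SLaw₁₃ F N (θ.pinX3 F N lam8 lam12 lam13) P k → TLaw₁₃ F N (θ.pinX3 F N lam8 lam12 lam13) P k)
    (h12 : ∀ P : B12.RunParams, B15Leaf (WOfRecord₁₃ F N (θ.pinX3 F N lam8 lam12 lam13) lamW P))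
    (hR : ∀ (P : B12.RunParams) (k : ℕ), k < P.K → TLaw₁₃ F N (θ.pinX3 F N lam8 lam12 lam13) P k → SLaw₁₃ F N (θ.pinX3 F N lam8 lam12 lam13) P (k + 1))
    (hUV : ∀ P : B12.RunParams, (genFlow (betaOfRecord₁₃ F N (θ.pinX3 F N lam8 lam12 lam13)) P.g0).InInterval w.γ P.K → ∀ k, k ≤ P.K →
      SLaw₁₃ F N (θ.pinX3 F N lam8 lam12 lam13) P k → ∀ U : GaugeField (F.P P.K) k (SU N),
        chiβOfRecord₁₃ F N (θ.pinX3 F N lam8 lam12 lam13) P.K (gOfRecord₁₃ F N (θ.pinX3 F N lam8 lam12 lam13) P) k U *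
              Real.exp (-(1 / (gOfRecord₁₃ F N (θ.pinX3 F N lam8 lam12 lam13) P k) ^ 2 * wilsonBGOfRecord F N (θ.pinX3 F N lam8 lam12 lam13).εbg P k U)
                - w.em (gOfRecord₁₃ F N (θ.pinX3 F N lam8 lam12 lam13) P k) * (Fintype.card (Site (F.P P.K) k) : ℝ)) ≤
            densOfRecord₁₃ F N (θ.pinX3 F N lam8 lam12 lam13) P k U ∧
        densOfRecord₁₃ F N (θ.pinX3 F N lam8 lam12 lam13) P k U ≤
          Real.exp (w.ep (gOfRecord₁₃ F N (θ.pinX3 F N lam8 lam12 lam13) P k) * (Fintype.card (Site (F.P P.K) k) : ℝ))) :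
    ∃ (θ' : Stage13Params F N) (h' : θ'.Provisos₁₃ F N) (w' : WorldP), (θ'.ZtUnity F N ∧ θ'.SlotsNondegenerate₁₃ F N) ∧ θ'.Admissible F N ∧
      IsRecordOfRecord₁₃C F N (datumOfRecord₁₃ F N θ' h') w' ∧ ∀ P : B12.RunParams, Nodes (leavesP w' P) := by
  obtain ⟨hrec, hn⟩ := nodes₁₃B10YZW_pointed_pinX3_of_leaves θ hP hθ lam8 lam12 lam13 Mstar ops ζ lamW w hC hγ hL hup h05 h09 h10 h06 h07 h08
    h09T h11 h12 hR hUV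
  exact ⟨θ, hP, w, hU, hθ, hrec, hn⟩

end Summit.QuantumFields.YangMills.BalabanUVNodes.N10AtXPinned13
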